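/-
Copyright (c) 2026 the pub-hodgecm-mathlib formalisation cell (harness21).  Track B «K2-LIT» prover seat hodgecm-mathlib-K2E4-p14 (g4), 2026-09-04:
‹S› ROAD J, road (d-w) of K2E3-p03 (g3), brick (C2b-ii) FILE A2b — THE COUNT `[Λ¹ : Λ¹ ∩ (1 + 4Λ)] = q^{6m−⌊d∕2⌋}` for the norm-one group of the order `Λ = 𝒪_E ⊕ 𝒪_E·j` (datum currency).
-/
import Summits.HodgeConjecture.HodgeConjecture.Theorems.K2E3WildOrderUnitGroupNormImage   -- ★ FILE A1b (this seat): `nrd(Λ^×) = 𝒪_F^×`, `nrd(1+4Λ) = U_F^{(2m+⌊d∕2⌋)}`; brings ★ FILE A1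
import Summits.HodgeConjecture.HodgeConjecture.Theorems.K2E3WildOrderResidueCounts        -- ★ FILE A2a (this seat): `[G : G₁] = (q−1)q`, `[G_k : G_{k′}] = q^{2(k′−k)}`, `relIndex_sup_eq_relIndex_of_normal`
import Literature.NumberTheory.LocalFields.RamifiedQuadraticResidueCountsUnits              -- ★ `relIndex_fixedUnitLevel_eq` (`[𝒪_F^× : U_F^{(n)}] = (q−1)q^{⌈n∕2⌉−1}` in E-depth `n`)
import HarnessLib

/-!
# (C2b-ii) in datum currency: `[Λ¹ : Λ¹ ∩ (1 + 4Λ)] = q^{6m−⌊d∕2⌋}` for the norm-one group of the order `Λ = 𝒪_E ⊕ 𝒪_E·j` of `⟨1,−ξ⟩` at a wild ramified quadratic datum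
# (Kottwitz 1988 §1; Riehm 1970; Serre, *Local Fields* V §3)

Cell `pub/hodgecm-mathlib`, Track B «K2-LIT», crux H413 = `stmt-HodgeConjecture-24833` (supports-only, `--as helper`, count-neutral); ‹S› ROAD J, road (d-w) of ‹J3› v2 (owner
K2E3-p03 (g3)); letter (C2) `sig_K2E3WildAnisotropicResidualCount` = (C2-struct) · (C2a) ★ p857092 · (C2b-i) · **(C2b-ii)** (this seat; road owner 03:36:47Z (2), dealer K2E3-plan (g3)
03:38:10Z (R2); census 03:39:19Z «=» 03:41:14Z).  THEOREMS ONLY (no `def`, no `instance`, no notation, no named fact, no `sorry`).  FILE A2b = the assembly (A1 ★ p857193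
`K2E3WildOrderUnitGroup`, A1b ★ p857217 `K2E3WildOrderUnitGroupNormImage`, A2a `K2E3WildOrderResidueCounts`; FILE B = the CM ∕ `levelOf` dress).

THE ROAD.  `G = Λ^×` (★ A1 membership letter), `N = G_{4m} = Λ^× ∩ (1 + 4Λ)` (`|2| = |ϖ|^{2m}`), `f = det : G → 𝒪_F^×`, `A = ker f = Λ¹`.  Then
`[A : A ∩ N] · [f(G) : f(N)] = [G : N]` (★ A2a `relIndex_sup_eq_relIndex_of_normal` for `[N ⊔ A : N] = [A : A ∩ N]`, Mathlib `relIndex_map_map` for `[G : N ⊔ A] = [f(G) : f(N)]`), with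
`[G : N] = [G : G₁]·[G₁ : G_{4m}] = (q−1)q·q^{2(4m−1)}` (★ A2a) and `[f(G) : f(N)] = [𝒪_F^× : U_F^{(2m+⌊d∕2⌋)}] = (q−1)q^{2m+⌊d∕2⌋−1}` (★ A1b images + ★ `relIndex_fixedUnitLevel_eq` at E-depth
`4m + 2⌊d∕2⌋`); `(q−1)q^{2m+⌊d∕2⌋−1}` cancels (`⌊d∕2⌋ ≤ m` by `d ≤ t+1 = 2m+1`):
* **`relIndex_normOne_level_eq_pow`**: `[Λ¹ : Λ¹ ∩ (1+4Λ)] = q^{6m−⌊d∕2⌋}` — the subgroups `A = {shape, integral, det = 1}` and `B = {g ∈ A : |g₀₀ − 1|, |g₁₀| ≤ exp(−4m)}` of `GL₂(K)` by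
  membership letters (`ξ` a fixed unit; no norm hypothesis on `ξ` is needed for the count);
* **`relIndex_normOne_level_eq_pow_of_injective`**: the same for subgroups `B ≤ A` of ANY group `Γ` whose images under an injective `ι : Γ →* GL₂(K)` have those letters (the form FILE B
  applies to the CM carrier `(cmDatum L 2 ⟨1,−ξ⟩).Local v` along the one-place model ★ `localNonsplitEquiv`).
Numerics (road owner's ladders, `K2/K2E3-p03/g3/NUMERICS-W3-Q2…`): (q,m,d) = (2,1,2) 32 = 2^{6−1} ✓, (2,1,3) 32 ✓, (4,1,2) 1024 = 4^5 ✓, (2,2,2) 2048 = 2^{11} ✓, (2,2,4) 1024 = 2^{10} ✓.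
HONEST LABEL: HC_CM is proved only modulo the 7 printed citations (2 remaining named inputs: hLiu418 = `stmt-HodgeConjecture-24832`, h413 = `stmt-HodgeConjecture-24833`) until rung 0
closes; count-neutral; (C2b-ii) is proved here IN DATUM CURRENCY only — the CM-carrier letter is FILE B; (C2)∕(W3) are NOT proved here.

## References
* [Kottwitz1988] R. E. Kottwitz, *Tamagawa numbers*, Ann. of Math. 127 (1988), §1 Thm. 1 (the place-freeness that (C2) expresses).
* [Riehm1970] C. Riehm, *The norm 1 group of a 𝔭-adic division algebra*, Amer. J. Math. 92 (1970), §§1–2.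
* [Serre1979] J.-P. Serre, *Local Fields*, GTM 67 (1979), Ch. V §3 Prop. 5, Cor. 3; Ch. IV §2 Prop. 6.
* [VignerasLNM800] M.-F. Vignéras, *Arithmétique des algèbres de quaternions*, LNM 800 (1980), Ch. II §1.
-/

set_option autoImplicit false
set_option linter.dupNamespace false

noncomputable section

open WithZero Matrix
open scoped Valued MatrixGroups
open Literature.NumberTheory.Automorphic.UnitaryThreeFourFrame (IsRamifiedQuadraticDatum)
open Literature.NumberTheory.LocalFields.WildQuadraticDatum
open Summit.HodgeConjecture.HodgeConjecture.Cruxes.H413.K2E3WildOrderUnitGroup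
open Summit.HodgeConjecture.HodgeConjecture.Cruxes.H413.K2E3WildOrderUnitGroupNormImage
open Summit.HodgeConjecture.HodgeConjecture.Cruxes.H413.K2E3WildOrderResidueCounts

namespace Summit.HodgeConjecture.HodgeConjecture.Cruxes.H413.K2E3WildOrderNormOneLevelCount

/-! ## §3 Assembly: `[Λ¹ : Λ¹ ∩ (1 + 4Λ)] · [𝒪_F^× : U_F^{(2m+⌊d∕2⌋)}] = [Λ^× : 1 + 4Λ]`, hence `[Λ¹ : Λ¹ ∩ (1 + 4Λ)] = q^{6m−⌊d∕2⌋}` -/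

section Assembly

variable {K : Type} [Field K] [Valued K ℤᵐ⁰] [CompleteSpace K] [Finite 𝓀[K]] {σ : K →+* K} {ϖ ξ : K} {d t : ℕ}

/-- **(C2b-ii) IN DATUM CURRENCY: `[Λ¹ : Λ¹ ∩ (1 + 4Λ)] = q^{6m−⌊d∕2⌋}`** at a wild ramified quadratic datum with `|2| = |ϖ|^{2m}` (`m ≥ 1`), for the NORM-ONE group `Λ¹ = A` of the order of
`⟨1,−ξ⟩` (`ξ` a fixed unit, no norm condition needed) — the subgroup of `GL₂(K)` of shape matrices `[[a, ξσc],[c, σa]]` with `a, c` integral and `det = aσa − ξcσc = 1` — and its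
level `B = A ∩ (1 + 4Λ)` (`|a − 1|, |c| ≤ |4| = exp(−4m)`), both by membership letters.  `[A : B]·[𝒪_F^× : U_F^{(2m+⌊d∕2⌋)}] = [Λ^× : 1+4Λ] = (q−1)q^{8m−1}` (§1–§2, ★ A1b images, ★
`relIndex_fixedUnitLevel_eq`), and `(q−1)q^{2m+⌊d∕2⌋−1}` cancels (`⌊d∕2⌋ ≤ m` by `d ≤ t + 1`).  `q = #𝓀[K]`, `d ∕ 2` is `ℕ`-division.
[cite: Kottwitz1988, §1 Thm. 1] [cite: Riehm1970, §§1–2] [cite: Serre1979, Ch. V §3 Cor. 3] -/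
theorem relIndex_normOne_level_eq_pow (hD : IsRamifiedQuadraticDatum σ ϖ d t) {m : ℕ} (htm : t = 2 * m) (hm1 : 1 ≤ m) (hσξ : σ ξ = ξ) (hξ1 : Valued.v ξ = 1)
    {A B : Subgroup (GL (Fin 2) K)}
    (hA : ∀ g : GL (Fin 2) K, g ∈ A ↔
      ((g : Matrix (Fin 2) (Fin 2) K) 0 1 = ξ * σ ((g : Matrix (Fin 2) (Fin 2) K) 1 0) ∧ (g : Matrix (Fin 2) (Fin 2) K) 1 1 = σ ((g : Matrix (Fin 2) (Fin 2) K) 0 0) ∧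
        Valued.v ((g : Matrix (Fin 2) (Fin 2) K) 0 0) ≤ 1 ∧ Valued.v ((g : Matrix (Fin 2) (Fin 2) K) 1 0) ≤ 1 ∧ (g : Matrix (Fin 2) (Fin 2) K).det = 1))
    (hB : ∀ g : GL (Fin 2) K, g ∈ B ↔
      g ∈ A ∧ Valued.v ((g : Matrix (Fin 2) (Fin 2) K) 0 0 - 1) ≤ exp (-((4 * m : ℕ) : ℤ)) ∧ Valued.v ((g : Matrix (Fin 2) (Fin 2) K) 1 0) ≤ exp (-((4 * m : ℕ) : ℤ))) :
    B.relIndex A = Nat.card 𝓀[K] ^ (6 * m - d / 2) := by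
  classical
  have hD' := hD
  obtain ⟨hσ, hvσ, hϖ, hfix, hd, -, ht⟩ := hD'
  have hdt : d ≤ t + 1 := d_le_succ_t hσ hfix hϖ hd ht
  have h2v : Valued.v (2 : K) < 1 := by rw [ht, v_varpi_pow hϖ, htm, ← exp_zero, exp_lt_exp]; omega
  -- the order unit group `G = Λ^×`, its levels `G₁`, `Gn = G_{4m}`
  obtain ⟨G, hG⟩ := exists_subgroup_orderUnits hσ hvσ hσξ hξ1
  obtain ⟨G₁, hG₁⟩ := exists_subgroup_orderUnits_level hvσ hξ1 hG 1
  obtain ⟨Gn, hGn⟩ := exists_subgroup_orderUnits_level hvσ hξ1 hG (4 * m)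
  have hAG : A ≤ G := fun g hg => by
    obtain ⟨h01, h11, ha, hc, hdet⟩ := (hA g).1 hg
    exact (hG g).2 ⟨h01, h11, ha, hc, by rw [hdet, map_one]⟩
  have hG₁G : G₁ ≤ G := fun g hg => ((hG₁ g).1 hg).1
  have hGnG₁ : Gn ≤ G₁ := fun g hg => by
    obtain ⟨hgG, ha, hc⟩ := (hGn g).1 hg
    have hle : exp (-((4 * m : ℕ) : ℤ)) ≤ exp (-((1 : ℕ) : ℤ)) := exp_le_exp.2 (by push_cast; omega)
    exact (hG₁ g).2 ⟨hgG, ha.trans hle, hc.trans hle⟩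
  -- `f = det` on `↥G`, `A = ker f`, `B = Gn ⊓ A`
  set f : G →* Kˣ := Matrix.GeneralLinearGroup.det.comp G.subtype with hf
  have hfapply : ∀ x : G, ((f x : Kˣ) : K) = ((x : GL (Fin 2) K) : Matrix (Fin 2) (Fin 2) K).det := fun x => Matrix.GeneralLinearGroup.val_det_apply _
  have hkerA : f.ker.map G.subtype = A := by
    ext g
    constructor
    · rintro ⟨x, hx, rfl⟩
      obtain ⟨h01, h11, ha, hc, -⟩ := (hG x).1 x.2
      refine (hA _).2 ⟨h01, h11, ha, hc, ?_⟩
      have hx1 : f x = 1 := hx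
      rw [Subgroup.coe_subtype, ← hfapply, hx1, Units.val_one]
    · intro hg
      refine ⟨⟨g, hAG hg⟩, ?_, rfl⟩
      change f ⟨g, hAG hg⟩ = 1
      exact Units.ext (by rw [hfapply, Units.val_one]; exact ((hA g).1 hg).2.2.2.2)
  have hNB : (Gn.subgroupOf G).map G.subtype ⊓ A = B := by
    rw [Subgroup.subgroupOf_map_subtype]
    ext g
    rw [Subgroup.mem_inf, Subgroup.mem_inf, hB, hGn]
    constructor
    · rintro ⟨⟨⟨-, ha, hc⟩, -⟩, hgA⟩; exact ⟨hgA, ha, hc⟩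
    · rintro ⟨hgA, ha, hc⟩; exact ⟨⟨⟨hAG hgA, ha, hc⟩, hAG hgA⟩, hgA⟩
  -- `[A : B]` read in `↥G`
  have hX : B.relIndex A = (Gn.subgroupOf G).relIndex f.ker := by
    rw [← Subgroup.relIndex_map_map_of_injective (Gn.subgroupOf G) f.ker G.subtype_injective, hkerA, ← hNB, Subgroup.inf_relIndex_right]
  -- the images `f(⊤) = 𝒪_F^×`, `f(Gn) = U_F^{(2m+⌊d∕2⌋)}` (★ A1b)
  have hU : ∀ u : Kˣ, u ∈ Subgroup.map f ⊤ ↔ σ u = u ∧ Valued.v (u : K) = 1 := by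
    intro u
    constructor
    · rintro ⟨x, -, rfl⟩
      rw [hfapply]
      exact det_fixed_of_mem hσ hσξ hG x.2
    · rintro ⟨hσu, hu1⟩
      obtain ⟨g, hg, hgu⟩ := exists_mem_det_eq_of_fixed_unit hD h2v hσξ hξ1 hG hσu hu1
      exact ⟨⟨g, hg⟩, Subgroup.mem_top _, Units.ext (by rw [hfapply, Subgroup.coe_mk, hgu])⟩
  have hUn : ∀ u : Kˣ, u ∈ Subgroup.map f (Gn.subgroupOf G) ↔
      (σ u = u ∧ Valued.v (u : K) = 1) ∧ Valued.v ((u : K) - 1) ≤ exp (-((4 * m + 2 * (d / 2) : ℕ) : ℤ)) := by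
    intro u
    constructor
    · rintro ⟨x, hx, rfl⟩
      have hx' : (x : GL (Fin 2) K) ∈ Gn := hx
      obtain ⟨-, ha, hc⟩ := (hGn _).1 hx'
      rw [hfapply]
      exact ⟨det_fixed_of_mem hσ hσξ hG x.2, valued_det_sub_one_le_of_level hD hξ1 htm hG x.2 ha hc⟩
    · rintro ⟨⟨hσu, -⟩, hul⟩
      obtain ⟨g, hg, ha, hc, hgu⟩ := exists_mem_level_det_eq_of_fixed_unit_level hD htm hm1 hG hσu hul
      refine ⟨⟨g, hg⟩, ?_, Units.ext (by rw [hfapply, Subgroup.coe_mk, hgu])⟩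
      change (⟨g, hg⟩ : G) ∈ Gn.subgroupOf G
      rw [Subgroup.mem_subgroupOf]
      exact (hGn g).2 ⟨hg, ha, hc⟩
  have hq : (Subgroup.map f (Gn.subgroupOf G)).relIndex (Subgroup.map f ⊤) =
      (Nat.card 𝓀[K] - 1) * Nat.card 𝓀[K] ^ ((4 * m + 2 * (d / 2) + 1) / 2 - 1) :=
    relIndex_fixedUnitLevel_eq hσ hvσ hfix hϖ hd hU (by omega) hUn
  -- the index identity `[G : N] = [A : A ∩ N] · [f(G) : f(N)]`
  have h1 : (Gn.subgroupOf G).index = (Gn.subgroupOf G).relIndex f.ker * (Subgroup.map f (Gn.subgroupOf G)).relIndex (Subgroup.map f ⊤) := by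
    rw [Subgroup.relIndex_map_map, top_sup_eq, Subgroup.relIndex_top_right, ← relIndex_sup_eq_relIndex_of_normal (Gn.subgroupOf G) f.ker,
      Subgroup.relIndex_mul_index le_sup_left]
  -- `[G : N] = [G : G₁] · [G₁ : G_{4m}]`
  have h2 : (Gn.subgroupOf G).index = Nat.card 𝓀[K] ^ (2 * (4 * m - 1)) * ((Nat.card 𝓀[K] - 1) * Nat.card 𝓀[K]) := by
    change Gn.relIndex G = _
    rw [← Subgroup.relIndex_mul_relIndex Gn G₁ G hGnG₁ hG₁G, relIndex_level_one_eq hD h2v hξ1 hG hG₁, relIndex_level_eq_pow hD hξ1 hG (le_refl 1) (by omega) hG₁ hGn]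
  -- arithmetic
  have hq1 : 1 < Nat.card 𝓀[K] := Finite.one_lt_card
  set q := Nat.card 𝓀[K] with hqdef
  set e := d / 2 with hedef
  have hem : e ≤ m := by omega
  have hC : 0 < (q - 1) * q ^ ((4 * m + 2 * e + 1) / 2 - 1) := Nat.mul_pos (by omega) (pow_pos (by omega) _)
  have hlhs : (Gn.subgroupOf G).relIndex f.ker * ((q - 1) * q ^ ((4 * m + 2 * e + 1) / 2 - 1)) = q ^ (2 * (4 * m - 1)) * ((q - 1) * q) := by
    rw [← hq, ← h1, h2]
  rw [hX]
  refine Nat.eq_of_mul_eq_mul_right hC ?_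
  rw [hlhs]
  have hexp : 2 * (4 * m - 1) + 1 = (6 * m - e) + ((4 * m + 2 * e + 1) / 2 - 1) := by omega
  calc q ^ (2 * (4 * m - 1)) * ((q - 1) * q) = (q - 1) * q ^ (2 * (4 * m - 1) + 1) := by ring
    _ = (q - 1) * q ^ ((6 * m - e) + ((4 * m + 2 * e + 1) / 2 - 1)) := by rw [hexp]
    _ = q ^ (6 * m - e) * ((q - 1) * q ^ ((4 * m + 2 * e + 1) / 2 - 1)) := by rw [pow_add]; ring

/-- **(C2b-ii) THROUGH AN INJECTIVE HOMOMORPHISM** `ι : Γ →* GL₂(K)` (the form the CM dress applies to the one-place model `(cmDatum L 2 ⟨1,−ξ⟩).Local v ≃* U(σ_w, ⟨1,−ξ_w⟩) ≤ GL₂(L_w)`):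
if the images `A.map ι`, `B.map ι` of subgroups `B ≤ A ≤ Γ` are the norm-one order group and its level-`4m` subgroup (membership letters), then `[A : B] = q^{6m−⌊d∕2⌋}`
(Mathlib `Subgroup.relIndex_map_map_of_injective`). [cite: Kottwitz1988, §1 Thm. 1] [cite: Riehm1970, §§1–2] -/
theorem relIndex_normOne_level_eq_pow_of_injective (hD : IsRamifiedQuadraticDatum σ ϖ d t) {m : ℕ} (htm : t = 2 * m) (hm1 : 1 ≤ m) (hσξ : σ ξ = ξ)
    (hξ1 : Valued.v ξ = 1) {Γ : Type*} [Group Γ] {ι : Γ →* GL (Fin 2) K} (hι : Function.Injective ι) {A B : Subgroup Γ}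
    (hA : ∀ g : GL (Fin 2) K, g ∈ A.map ι ↔
      ((g : Matrix (Fin 2) (Fin 2) K) 0 1 = ξ * σ ((g : Matrix (Fin 2) (Fin 2) K) 1 0) ∧ (g : Matrix (Fin 2) (Fin 2) K) 1 1 = σ ((g : Matrix (Fin 2) (Fin 2) K) 0 0) ∧
        Valued.v ((g : Matrix (Fin 2) (Fin 2) K) 0 0) ≤ 1 ∧ Valued.v ((g : Matrix (Fin 2) (Fin 2) K) 1 0) ≤ 1 ∧ (g : Matrix (Fin 2) (Fin 2) K).det = 1))
    (hB : ∀ g : GL (Fin 2) K, g ∈ B.map ι ↔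
      g ∈ A.map ι ∧ Valued.v ((g : Matrix (Fin 2) (Fin 2) K) 0 0 - 1) ≤ exp (-((4 * m : ℕ) : ℤ)) ∧ Valued.v ((g : Matrix (Fin 2) (Fin 2) K) 1 0) ≤ exp (-((4 * m : ℕ) : ℤ))) :
    B.relIndex A = Nat.card 𝓀[K] ^ (6 * m - d / 2) := by
  rw [← Subgroup.relIndex_map_map_of_injective B A hι]
  exact relIndex_normOne_level_eq_pow hD htm hm1 hσξ hξ1 hA hB

end Assembly

end Summit.HodgeConjecture.HodgeConjecture.Cruxes.H413.K2E3WildOrderNormOneLevelCount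

end
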